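import Summits.KontsevichZagierPeriods.KontsevichZagierPeriods.Theses.HermiteRigidity
import Literature.NumberTheory.Transcendental.KZRelationsLE

/-!
# KontsevichZagierPeriods / HermiteRigidity — `ReductionRigidityOfKernelForm` (stmt-KontsevichZagierPeriods-14406)

Route `KontsevichZagierPeriods/HermiteRigidity`, support item stmt-KontsevichZagierPeriods-14406
(`ReductionRigidityOfKernelForm`, rank 9), the glue from the kernel form of Conjecture 1 to the
route's rank-0 target `ReductionRigidity`:

  `(∀ c : KZ.FormalRep, KZ.eval c = 0 → c ∈ KZ.relations) → ReductionRigidity`.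

Proof. Let `K = algebraicClosure ℚ ℝ` be the field of real algebraic numbers and `Vals ⊆ ℝ` the
set of values of all integral representations. Mathlib's `exists_linearIndependent` gives a
`K`-linearly independent `T ⊆ Vals` with `span_K T = span_K Vals`; choose a section `ρ : T → Σ n,
KZ.IntegralRep n` of `value` and put `B := range ρ`.

* RIGIDITY: `value` is injective on `B` with image `T`, so the family `b ↦ value b` on `B` is
  `K`-linearly independent (`LinearIndependent.comp`); a vanishing combination
  `∑_{b ∈ F} β b · value b = 0` with `F ⊆ B` and real-algebraic `β` is a vanishing `K`-combination
  (`linearIndependent_iff'`), so `β = 0` on `F`.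
* REDUCTION: for any representation `r`, `value r ∈ span_K T` (`Submodule.mem_span_set`):
  `value r = ∑_{t ∈ supp c} c t · t` with `c t ∈ K`. Each summand is the value of the rescaled copy
  `(ρ t).constMul (c t)` (`KZ.IntegralRep.constMul`: same domain, integrand `c t · f`, again a
  representation since real algebraic constants are `ℚ`-semialgebraic; `KZ.IntegralRep.value_constMul`),
  whose class is a generator of the rescaling subgroup `N(B)`. Hence
  `x := ∑_t [(ρ t).constMul (c t)] ∈ N(B)` and `eval ([r] − x) = value r − ∑_t c t · t = 0`, so
  `[r] − x ∈ KZ.relations` by the kernel hypothesis.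

(The rationality hypothesis on `r` is not needed.) Adapted from the planners' sketches attached to
the item (route-choice `Sketch.lean`; crux-ideate `SketchIdeator2.lean`,
`reductionRigidity_of_kernelForm`).

References: M. Kontsevich, D. Zagier, *Periods* (2001), §1.2; A. Huber, S. Müller-Stach,
*Periods and Nori Motives* (2017), §13.1.
-/

noncomputable section

open Set

namespace Summit.KontsevichZagierPeriods.HermiteRigidity.ReductionRigidityOfKernelForm

open Literature.NumberTheory.Transcendental

/-- **`ReductionRigidityOfKernelForm`** (item stmt-KontsevichZagierPeriods-14406 of route
HermiteRigidity): the kernel form of Kontsevich–Zagier's Conjecture 1 (every formal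
`ℤ`-combination of integral representations of value `0` is a relation of the KZ calculus) implies
`ReductionRigidity`: there is a family `B` of integral representations whose values are linearly
independent over the real algebraic numbers and into whose rescaling subgroup `N(B)` every
(rational-shape) representation reduces modulo `KZ.relations`. Take `B` = a section of `value`
over a maximal real-algebraically independent subset of the set of all values
(`exists_linearIndependent` over `algebraicClosure ℚ ℝ`); RIGIDITY is `linearIndependent_iff'`,
REDUCTION is `Submodule.mem_span_set` with rescaled copies `KZ.IntegralRep.constMul` and the
kernel hypothesis applied to `[r] − ∑ [sᵢ]`, of value `0`.
[Kontsevich–Zagier 2001, §1.2; Huber–Müller-Stach 2017, §13.1] [folklore] -/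
theorem reductionRigidityOfKernelForm_proof :
    Summit.KontsevichZagierPeriods.KontsevichZagierPeriods.Theses.HermiteRigidity.ReductionRigidityOfKernelForm := by
  unfold Summit.KontsevichZagierPeriods.KontsevichZagierPeriods.Theses.HermiteRigidity.ReductionRigidityOfKernelForm
    Summit.KontsevichZagierPeriods.KontsevichZagierPeriods.Theses.HermiteRigidity.ReductionRigidity
  intro hK
  classical
  -- the field of real algebraic numbers and the set of all values
  set K : IntermediateField ℚ ℝ := algebraicClosure ℚ ℝ with hKdef
  let Vals : Set ℝ := Set.range (fun s : Σ n, KZ.IntegralRep n => s.2.value)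
  obtain ⟨T, hTV, hTspan, hTli⟩ := exists_linearIndependent K Vals
  -- a section of `value` over `T`
  have hsec : ∀ t : T, ∃ s : Σ n, KZ.IntegralRep n, s.2.value = (t : ℝ) := fun t => hTV t.2
  choose ρ hρ using hsec
  refine ⟨Set.range ρ, ?_, ?_⟩
  · -- RIGIDITY
    intro F β hFB hβ hsum b hb
    -- the values of `B = range ρ` form a `K`-linearly independent family
    have hval : ∀ x : Set.range ρ, (x : Σ n, KZ.IntegralRep n).2.value ∈ T := by
      rintro ⟨x, t, rfl⟩
      rw [hρ t]
      exact t.2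
    let f : Set.range ρ → T := fun x => ⟨_, hval x⟩
    have hf : Function.Injective f := by
      rintro ⟨x, t, rfl⟩ ⟨x', t', rfl⟩ h
      have h1 : (ρ t).2.value = (ρ t').2.value := congrArg (fun y : T => (y : ℝ)) h
      rw [hρ t, hρ t'] at h1
      have : t = t' := Subtype.ext h1
      subst this
      rfl
    have hBli :
        LinearIndependent K (fun x : Set.range ρ => (x : Σ n, KZ.IntegralRep n).2.value) :=
      hTli.comp f hf
    rw [linearIndependent_iff'] at hBli
    -- the coefficients as elements of `K`
    let g : Set.range ρ → K := fun x =>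
      if hx : (x : Σ n, KZ.IntegralRep n) ∈ F then
        ⟨β x, mem_algebraicClosure_iff.mpr (hβ x hx)⟩ else 0
    have hsmul : ∀ (k : K) (x : ℝ), k • x = (k : ℝ) * x := fun k x => rfl
    have key := hBli (F.subtype (· ∈ Set.range ρ)) g ?_ ⟨b, hFB hb⟩ (Finset.mem_subtype.mpr hb)
    · have hgb : g ⟨b, hFB hb⟩ = ⟨β b, mem_algebraicClosure_iff.mpr (hβ b hb)⟩ := dif_pos hb
      rw [hgb] at key
      exact congrArg (fun y : K => (y : ℝ)) key
    · -- the `K`-combination is the given real combination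
      have h1 : ∀ x ∈ F.subtype (· ∈ Set.range ρ),
          g x • (x : Σ n, KZ.IntegralRep n).2.value
            = β x * (x : Σ n, KZ.IntegralRep n).2.value := by
        intro x hx
        have hxF : (x : Σ n, KZ.IntegralRep n) ∈ F := Finset.mem_subtype.mp hx
        have : g x = ⟨β x, mem_algebraicClosure_iff.mpr (hβ x hxF)⟩ := dif_pos hxF
        rw [this, hsmul]
      rw [Finset.sum_congr rfl h1]
      rw [Finset.sum_subtype_of_mem (fun x : Σ n, KZ.IntegralRep n => β x * x.2.value)
        (fun x hx => hFB hx)]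
      exact hsum
  · -- REDUCTION
    intro n r _
    have hr : r.value ∈ Submodule.span K T := by
      rw [hTspan]
      exact Submodule.subset_span ⟨⟨n, r⟩, rfl⟩
    obtain ⟨c, hcT, hcsum⟩ := Submodule.mem_span_set.mp hr
    -- the rescaled copies
    have halg : ∀ t : ℝ, IsAlgebraic ℚ ((c t : K) : ℝ) := fun t =>
      mem_algebraicClosure_iff.mp (c t).2
    let sc : c.support → Σ n, KZ.IntegralRep n := fun t =>
      ⟨(ρ ⟨t, hcT t.2⟩).1, (ρ ⟨t, hcT t.2⟩).2.constMul ((c t : K) : ℝ) (halg t)⟩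
    refine ⟨∑ t ∈ c.support.attach, KZ.of (sc t).2, ?_, ?_⟩
    · refine AddSubgroup.sum_mem _ fun t _ => AddSubgroup.subset_closure ?_
      refine ⟨ρ ⟨t, hcT t.2⟩, ⟨_, rfl⟩, (sc t).2, ((c t : K) : ℝ), halg t, rfl, ?_, rfl⟩
      intro p _
      rfl
    · apply hK
      have hx : KZ.eval (∑ t ∈ c.support.attach, KZ.of (sc t).2)
          = ∑ t ∈ c.support, ((c t : K) : ℝ) * t := by
        rw [map_sum]
        have h2 : ∀ t ∈ c.support.attach,
            KZ.eval (KZ.of (sc t).2) = ((c (t : ℝ) : K) : ℝ) * (t : ℝ) := by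
          intro t _
          rw [KZ.eval_of]
          change ((ρ ⟨t, hcT t.2⟩).2.constMul ((c t : K) : ℝ) (halg t)).value = _
          rw [KZ.IntegralRep.value_constMul, hρ]
        rw [Finset.sum_congr rfl h2]
        exact Finset.sum_attach c.support (fun t : ℝ => ((c t : K) : ℝ) * t)
      have hc' : (c.sum fun t k => k • t) = ∑ t ∈ c.support, ((c t : K) : ℝ) * t := rfl
      rw [map_sub, KZ.eval_of, hx, ← hc', hcsum, sub_self]

end Summit.KontsevichZagierPeriods.HermiteRigidity.ReductionRigidityOfKernelForm
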